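import Literature.MathematicalPhysics.QuantumFieldTheory.Balaban1983to89.B16Improved189FullBudgetIndex
import Literature.MathematicalPhysics.QuantumFieldTheory.Balaban1983to89.B16Improved189ArbitraryRegionFull

/-!
# `Balaban1983to89.B16Improved189FullBudgetWitness` — A6 ∕ A2 for the index-model route of [Balaban1989LargeFieldII]
pp. 384–387: the FLOW HYPOTHESES of [III] §2 carried by `B16Lem384Induction` §§8–10, `B16Improved189FullBudgetIndex` and
`B16Improved189ArbitraryRegionFull` (`hI hγ1 hR hbR h29a h27 hΘ`, `L ≥ 4`) JOINTLY INHABITED by an explicit static flow,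
and `controlsT_birth_ofIndex` ∕ `controls_ofIndex` INSTANTIATED at it with a horizon `K = 1` and a NON-ZERO terminal term

T. Bałaban, *Large field renormalization. II*, Commun. Math. Phys. **122** (1989) 355–392 [Balaban1989LargeFieldII]; [III] =
*Convergent renormalization expansions …*, Commun. Math. Phys. **119** (1988) 243–285 [Balaban1988Convergent] ((2.5), (2.7),
(2.9) pp. 255–256).

statement-level bookkeeping; proofs kernel-checked; nothing here is a claim about the Yang–Mills mass gap

THE LOCATED ITEM (referee ref-M READ-2 on p583371, LOCATED (i) ∕ A2: «the flow hypotheses of [III] §2 `hI hR hbR h29a h27 hΘ`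
carried as in B16Lem384Induction §§8–10, NOT jointly inhabited» — and the same has been true of `B16Lem384Induction.controls_ofIndex`
∕ `exists_reset_ofIndex` ∕ `invariant_all_ofIndex` since they landed).  THIS FILE exhibits ONE joint inhabitant of the whole
hypothesis set of `B16Improved189FullBudgetIndex.controlsT_birth_ofIndex` (hence of `B16Lem384Induction.controls_ofIndex`, whose
binders are a subset): the STATIC TOY FLOW `g_n ≡ e^{−1∕2}` (so `log g_n⁻² = 1`), `R_n ≡ 1 = L⁰` (the least power of `L`
dominating `(log g_n⁻²)^p = 1`, (2.5)), `β′ = 0`, any `β₀ ≥ 0`, any `L`, any horizon `K_f` — it satisfies `InInterval 1`,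
`IsRj`, (2.9a), `FlowIneq27`, and the located smallness `hΘ` at once (§1); and at `d = 1`, `L = 4`, `K_f = 1`, the one-cube
region `Z = {0}` born at scale `0` with horizon `K = 1`, `Nsz = 64`, `O(1) = M = 1`, `κ₁ = 1`, the clause and `3Q ≤ a` hold and
condition (i) for the terminal iterate `S(Z)` (21 cubes) holds, so `controlsT_birth_ofIndex` FIRES: (1.80)⁺ at scale `0` with the
terminal term `κ₁·d_1(S(Z)) = treeLen (S(Z)) ≥ 1 > 0` (§2; CERTIFIED is `1 ≤ treeLen (S(Z))` only — the value `20`, the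
tree length of the row of 21 cubes, is print-side prose, not proved and not needed; v1.0.1 docstring precision, ref-M g3 READ-45 NIT-1).  WHAT THIS SAYS (A6, honestly): the flow binders AS TYPED do not
force the couplings to run or the `R_n` to grow — a static flow inhabits them; the index-model theorems are therefore not
vacuous, and their content at a genuine Bałaban flow is exactly what the binders display.

WHAT THIS FILE PROVES (kernel-checked, zero `sorry`, theorems only; axioms standard):
§1 (private `log_inv_sq_gStatic`: `log (e^{−1∕2})⁻² = 1`), `inInterval_static`, `isRj_static`, `ratio29a_static`, `flowIneq27_static`,
   `theta_static` — the six flow binders at the static flow, for every `K_f`, `L ≥ 1`, `p`, `β₀ ≥ 0`.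
§2 (private `faceConnected_singleton`), `condI_Sop_singleton_static`, **`controlsT_birth_static`** — `controlsT_birth_ofIndex` instantiated
   (d = 1, L = 4, K_f = 1, Z = {0}, m = 0, K = 1, Nsz = 64, κ₁ = 1, `a = 3Q`): every binder discharged, conclusion (1.80)⁺ with
   the terminal term; `one_le_terminal_static` (`κ₁·d_1(S({0})) ≥ 1`: the term is not zero); **`improved189_full_static`** —
   base + one continuation (1.83) + the `K = 0` reading give the FULL-BUDGET improved (1.89) at the witness for any factor form of
   the p. 384 shape (end to end, only the factor form assumed).
HONEST SCOPE.  A toy inhabitant (static flow, one cube, one dimension) — an A2 witness, not a model of Bałaban's running coupling;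
count-neutral; N13 NOT discharged; one finite 𝕋⁴ programme at fixed ε, Bałaban AS PRINTED; R4 closes the conditional finite-𝕋⁴ rung
`BalabanLadder.UV` only — nothing continuum ∕ OS ∕ mass gap ∕ Clay.  Seat `pub-ymgap-dag-n13-w2` (g0), N13 [B16], W-SEAT-START-LIST §1
n13 item 2, `--supports stmt-QuantumFields-20542`.
-/

noncomputable section

namespace Literature.MathematicalPhysics.QuantumFieldTheory.Balaban1983to89.B16Improved189FullBudgetWitness

open Literature.MathematicalPhysics.QuantumFieldTheory.Balaban1983to89
open Literature.MathematicalPhysics.QuantumFieldTheory.Balaban1983to89.Step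
open Literature.MathematicalPhysics.QuantumFieldTheory.Balaban1983to89.Step.Budget
open Literature.MathematicalPhysics.QuantumFieldTheory.Balaban1983to89.B16Improved189FullBudgetIndex
open Literature.MathematicalPhysics.QuantumFieldTheory.Balaban1983to89.B13ScaleTransfer
open Literature.MathematicalPhysics.QuantumFieldTheory.Balaban1983to89.TreeLength
open Literature.MathematicalPhysics.QuantumFieldTheory.Balaban1983to89.B16SProfile
open Literature.MathematicalPhysics.QuantumFieldTheory.Balaban1983to89.B16StoppingRule
open Literature.MathematicalPhysics.QuantumFieldTheory.Balaban1983to89.B16Lem384Induction (condI_of_subset_box)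
open Literature.MathematicalPhysics.QuantumFieldTheory.Balaban1983to89.B13Factor210Literal (fineCubes)

/-! ## §1. The static toy flow inhabits the flow binders of [III] §2 -/

/-- The static coupling `g ≡ e^{−1∕2}` has `log g⁻² = 1`. [folklore] -/
private theorem log_inv_sq_gStatic : Real.log ((Real.exp (-1 / 2)) ^ 2)⁻¹ = 1 := by
  rw [pow_two, ← Real.exp_add, show (-1 / 2 : ℝ) + -1 / 2 = -1 by norm_num, Real.exp_neg, inv_inv, Real.log_exp]

/-- `InInterval 1 K_f` for the static flow: `0 < e^{−1∕2} ≤ 1`. [cite: Balaban1987RG1, Thm 1 p.259 (the interval ]0,γ])] -/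
theorem inInterval_static (Kf : ℕ) : Step.InInterval 1 Kf (fun _ => Real.exp (-1 / 2)) :=
  fun _ _ => ⟨Real.exp_pos _, by rw [Real.exp_le_one_iff]; norm_num⟩

/-- (2.5) for the static flow: `R_n = 1 = L⁰` is the least power of `L` dominating `(log g_n⁻²)^p = 1`. [cite: Balaban1988Convergent, (2.5) p.255] -/
theorem isRj_static (L p Kf : ℕ) : ∀ n, n ≤ Kf → B14.IsRj L p ((fun _ : ℕ => Real.exp (-1 / 2)) n) ((fun _ : ℕ => 1) n) := by
  intro n _
  refine ⟨0, by simp, ?_, fun _ _ => Nat.zero_le _⟩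
  show (Real.log ((Real.exp (-1 / 2)) ^ 2)⁻¹) ^ p ≤ ((1 : ℕ) : ℝ)
  rw [log_inv_sq_gStatic, one_pow, Nat.cast_one]

/-- (2.9), first member, for the static flow: `R_n = 1 ≤ L·R_m` (`L ≥ 1`). [cite: Balaban1988Convergent, (2.9) p.256] -/
theorem ratio29a_static {L : ℕ} (hL : 1 ≤ L) (Kf : ℕ) :
    ∀ m n, m < n → n ≤ Kf → (((fun _ : ℕ => (1 : ℕ)) n : ℕ) : ℝ) ≤ L * ((fun _ : ℕ => (1 : ℕ)) m : ℕ) := by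
  intro m n _ _
  have : (1 : ℝ) ≤ L := by exact_mod_cast hL
  simpa using this

/-- (2.7) for the static flow with `β′ = 0`, `β₀ ≥ 0`: both members read `1 ≤ 1 + β₀` ∕ `1 ≤ 1^{β₀}·1`. [cite: Balaban1988Convergent, (2.7) p.255] -/
theorem flowIneq27_static {β₀ : ℝ} (hβ₀ : 0 ≤ β₀) (p Kf : ℕ) :
    B14.FlowIneq27 (fun _ => Real.exp (-1 / 2)) 0 β₀ p Kf := by
  intro m n _ _
  simp only [log_inv_sq_gStatic, one_pow, mul_zero, zero_mul, add_zero, Real.one_rpow, one_mul]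
  exact ⟨by linarith, le_rfl⟩

/-- The located smallness `hΘ` for the static flow with `β′ = 0`: `(1 + 0)^{β₀} = 1 ≤ L^{⌊max(n−m,2)∕2⌋}` (`L ≥ 1`). [cite: Balaban1988Convergent, (2.9) p.256 (second member)] -/
theorem theta_static {L : ℕ} (hL : 1 ≤ L) (β₀ : ℝ) (Kf : ℕ) :
    ∀ m n, m < n → n ≤ Kf →
      (1 + ((fun _ : ℕ => Real.exp (-1 / 2)) n) ^ 2 * (0 : ℝ) * ((n : ℝ) - m)) ^ β₀ ≤ (L : ℝ) ^ (max (n - m) 2 / 2) := by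
  intro m n _ _
  simp only [mul_zero, zero_mul, add_zero, Real.one_rpow]
  exact one_le_pow₀ (by exact_mod_cast hL)

/-! ## §2. `controlsT_birth_ofIndex` instantiated: every binder discharged, non-zero terminal term -/

/-- A single cube is a face-connected family (the empty chain). [folklore] -/
private theorem faceConnected_singleton {d : ℕ} (x : Pt d) : FaceConnected ({x} : Finset (Pt d)) := by
  intro a ha c hc
  rw [Finset.mem_singleton] at ha hc
  subst ha; subst hc
  exact Relation.ReflTransGen.refl

/-- In dimension 1, `S({0}) = Z′^{~10}` with `R ≡ 1` (ratio `q₀ = L`) is the box of radius `11` around `coarse L 0 = 0`, hence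
satisfies condition (i) with `23 ≤ 64` cubes per side. [cite: Balaban1989LargeFieldI, p.177 (condition (i))] -/
theorem condI_Sop_singleton_static (L : ℕ) (hL : 0 < L) (σ : ℕ → ℕ) :
    CondI 64 (Siter (ratio L σ) 1 ({(0 : Pt 1)} : Finset (Pt 1))) := by
  rw [Siter_succ, Siter_zero]
  have hbox : ({(0 : Pt 1)} : Finset (Pt 1)) ⊆ box (0 : Pt 1) 0 := by
    intro y hy
    rw [Finset.mem_singleton] at hy
    subst hy
    exact mem_box_self _ _
  have h := (Sop_mono (ratio L σ 0) hbox).trans (Sop_box_subset (ratio_pos hL σ 0) (0 : Pt 1) 0)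
  exact (condI_of_subset_box h).mono (by norm_num)

/-- **THE HYPOTHESES OF `controlsT_birth_ofIndex` (AND OF `B16Lem384Induction.controls_ofIndex`) JOINTLY INHABITED, AND THE
THEOREM FIRES**: static flow (§1) on `[0, 1]`, `L = 4`, constants `O(1) = M = 1`, `d_b = 1`, `R ≡ 1`; the one-cube region
`Z = {0} ⊆ ℤ¹` born at scale `0` with horizon `K = 1 ≤ K_f`, size parameter `Nsz = 64`, cleanliness `⊤`, `hKmin` (every stopping
index is `≥ N = R₀ = 1`), condition (i) for the terminal iterate `S(Z)` (§2 above), `κ₁ = 1`, the clause `κ₁·((64·R₁)¹ − 1) = 63 ≤ Q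
= 10·126·(1·1·4²·1) = 20160`, and `a := 3Q`: (1.80)⁺ AT SCALE 0 for the (1.82)-budget lowered by the terminal term
`κ₁·d_1(S(Z)) = treeLen (fineCubes 1 (S(Z)))`. [cite: Balaban1989LargeFieldII, (1.80)–(1.82) pp.384–385] -/
theorem controlsT_birth_static :
    let b : Budget.Consts := ⟨1, 1, 1, fun _ => 1⟩
    let R : ℕ → ℕ := fun _ => 1
    let Z : Finset (Pt 1) := {0}
    let Q : ℝ := 10 * 126 ^ 1 * (b.C * b.M ^ b.d * ((4 : ℕ) : ℝ) ^ (b.d + 1) * b.R 0 ^ (b.d + 2))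
    Controls b 0 1 (3 * Q * (treeLen Z + 1) - b.cost 0 (treeLen Z)
        - 1 * treeLen (fineCubes (R (0 + 1)) (Siter (ratio 4 (fun i => Nat.log 4 (R (0 + i)))) 1 Z)))
      (fun n => treeLen (Siter (ratio 4 (fun i => Nat.log 4 (R (0 + i)))) (n - 0) Z)) := by
  intro b R Z Q
  have hQ : Q = 20160 := by simp [Q, b]; norm_num
  refine controlsT_birth_ofIndex b (L := 4) (p := 0) (Kf := 1) (by norm_num) (g := fun _ => Real.exp (-1 / 2))
    (γ := 1) (β' := 0) (β₀ := 0) (inInterval_static 1) le_rfl R (isRj_static 4 0 1) (fun _ _ => by simp [b, R])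
    (ratio29a_static (by norm_num) 1) (flowIneq27_static le_rfl 0 1) (theta_static (by norm_num) 0 1) zero_le_one zero_le_one
    (Finset.singleton_nonempty 0) (faceConnected_singleton 0) 0 1 (by norm_num) 64 (by norm_num) (fun _ => True)
    (fun _ _ _ => trivial) (fun K' hK' => le_of_stopAt hK') (condI_Sop_singleton_static 4 (by norm_num) _) zero_le_one ?_
    (3 * Q) le_rfl
  show (1 : ℝ) * ((((64 : ℕ) : ℝ) * ((R (0 + 1) : ℕ) : ℝ)) ^ 1 - 1) ≤ Q
  rw [hQ]
  simp [R]
  norm_num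

/-- **THE TERMINAL TERM OF THE WITNESS IS NOT ZERO**: `1 ≤ d_1(S({0})) = treeLen (S({0}))` in dimension 1 (`S({0})` is the row
of the 21 cubes `−10, …, 10`, whose tree length is `20` — a value NOT certified here: the theorem proves `1 ≤ …` only, which is all the
chain reads; `fineCubes 1 = id`) — so the strengthened statement (1.80)⁺ certified by `controlsT_birth_static` carries a strictly positive
additional term. [cite: Balaban1989LargeFieldII, p.384 (definition of S), p.387 (the additional term −κ₁d_k(X))] -/
theorem one_le_terminal_static :
    (1 : ℝ) ≤ treeLen (fineCubes 1 (Siter (ratio 4 (fun i => Nat.log 4 ((fun _ : ℕ => (1 : ℕ)) (0 + i)))) 1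
      ({(0 : Pt 1)} : Finset (Pt 1)))) := by
  rw [B16Ineq197ClassOne.fineCubes_one, Siter_succ, Siter_zero]
  exact B16Improved189ArbitraryRegionFull.one_le_treeLen_Sop
    Nat.one_pos (ratio_pos (by norm_num) _ 0) (Finset.singleton_nonempty 0) (faceConnected_singleton 0)

/-- **THE FULL-BUDGET IMPROVED (1.89) AT THE WITNESS, END TO END** (p. 387 ll. 23–27 at the toy flow): the birth certificate
of `controlsT_birth_static` ((1.80)⁺ at scale `0`, horizon `1`), ONE continuation step (1.83) to the horizon (`case1T_183`: at
scale `1` the component `S(Z)` has `K = 0` and the SAME terminal term), and (1.80)⁺ at `K = 0` read as `κ₁·d_1(S(Z)) ≤ κ_1`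
give, for any factor bound of the p. 384 form `𝐓′1 ≤ exp(−κ_1 − P)` with the profile slack `2(1+β₀)⁻¹p₀(g_1) ≤ P`, the
full-budget improved bound `𝐓′1 ≤ exp(−2(1+β₀)⁻¹p₀(g_1) − κ₁·d_1(S(Z)))` with `κ₁·d_1(S(Z)) ≥ 1` (`one_le_terminal_static`) —
`B16Improved189FullBudget.improved189_full_of_controlsT` BY NAME; base and step DISCHARGED, only the factor form assumed. [cite: Balaban1989LargeFieldII, (1.83) p.385, (1.89) p.387 ll.21–27] -/
theorem improved189_full_static {V : Type*} (T1X : V → ℝ) (A₀ : ℝ) (p₀ : ℕ) (β₀ gk P : ℝ)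
    (hP : 2 * (1 + β₀)⁻¹ * p0Profile A₀ p₀ gk ≤ P) :
    let b : Budget.Consts := ⟨1, 1, 1, fun _ => 1⟩
    let R : ℕ → ℕ := fun _ => 1
    let Z : Finset (Pt 1) := {0}
    let Q : ℝ := 10 * 126 ^ 1 * (b.C * b.M ^ b.d * ((4 : ℕ) : ℝ) ^ (b.d + 1) * b.R 0 ^ (b.d + 2))
    let prof : ℕ → ℝ := fun n => treeLen (Siter (ratio 4 (fun i => Nat.log 4 (R (0 + i)))) (n - 0) Z)
    let tZ : ℝ := 1 * treeLen (fineCubes (R (0 + 1)) (Siter (ratio 4 (fun i => Nat.log 4 (R (0 + i)))) 1 Z))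
    let κ1 : ℝ := 3 * Q * (treeLen Z + 1) - b.cost 0 (treeLen Z) - b.cost (0 + 1) (prof (0 + 1))
    (∀ v, T1X v ≤ Real.exp (-κ1 - P)) →
      ∀ v, T1X v ≤ Real.exp (-(2 * (1 + β₀)⁻¹ * p0Profile A₀ p₀ gk) - tZ) := by
  intro b R Z Q prof tZ κ1 hT
  have h0 : Controls b 0 1 (3 * Q * (treeLen Z + 1) - b.cost 0 (treeLen Z) - tZ) prof := controlsT_birth_static
  have h1 := B16Improved189FullBudget.case1T_183 b 0 1 le_rfl _ tZ prof h0
  have e : 3 * Q * (treeLen Z + 1) - b.cost 0 (treeLen Z) - b.cost (0 + 1) (prof (0 + 1)) - tZ = κ1 - tZ := rfl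
  rw [e] at h1
  have htZ : tZ = 1 * treeLen (fineCubes (R (0 + 1)) (Siter (ratio 4 (fun i => Nat.log 4 (R (0 + i)))) 1 Z)) := rfl
  rw [htZ] at h1 ⊢
  exact B16Improved189FullBudget.improved189_full_of_controlsT b (0 + 1) κ1 prof 1 _ h1 T1X A₀ p₀ β₀ gk P hT hP

end Literature.MathematicalPhysics.QuantumFieldTheory.Balaban1983to89.B16Improved189FullBudgetWitness

end
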